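import Literature.NumberTheory.Automorphic.IntegratedOperatorStar   -- ED. 2: ★ `apply_comp_integratedOperator` (left translations)
import HarnessLib

/-!
# Right-invariant test functions act through the fixed vectors; normal subgroups of an irreducible representation

For a unitary, strongly continuous representation `π` of a topological group `G` on a complex Hilbert space `H`,
a subgroup `K ≤ G`, a closed invariant subspace `W ≤ H` and a test function `f ∈ C_c(G)`:

* `integratedOperator_comp_apply_eq` — **right translations**: for a right-invariant measure `η`,
  `π(f) ∘ π(k) = π(ρ_k f)` with `(ρ_k f)(x) = f(x k⁻¹)` (the twin of ★ `apply_comp_integratedOperator`, which is the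
  left-translation formula `π(k) ∘ π(f) = π(λ_k f)`); hence `π(f) ∘ π(k) = π(f)` for every `k ∈ K` when `f` is RIGHT
  `K`-INVARIANT (`integratedOperator_comp_apply_eq_self_of_forall_mul_eq`).
* `apply_eq_zero_of_forall_comp_eq_of_forall_fixed_eq_zero` — **an operator that absorbs `K` on the right vanishes on a
  block without `K`-fixed vectors**: if `T ∘ π(k) = T` for all `k ∈ K` and the only `K`-fixed vector of `W` is `0`, then
  `T|_W = 0`.  Proof (Hilbert-space geometry, no Haar measure on `K`, no averaging projector): `T` kills the closed span
  `N ≤ W` of the vectors `π(k) v − v` (`k ∈ K`, `v ∈ W`); a vector `q ∈ W` orthogonal to `N` satisfies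
  `⟪π(k) q, q⟫ = ‖q‖²`, so `‖π(k) q − q‖² = 0` by unitarity, i.e. `q` is `K`-fixed, hence `q = 0`; thus `W ≤ N ≤ ker T`.
* `forall_fixed_or_forall_fixed_eq_zero_of_normal` — **dichotomy for a NORMAL subgroup on an IRREDUCIBLE block**: if `K` is
  normal in `G` and `W` is topologically irreducible then either `K` acts trivially on `W` or `W` has no non-zero `K`-fixed
  vector (the `K`-fixed vectors of `W` form a closed `G`-invariant subspace: `π(k) π(g) w = π(g) π(g⁻¹ k g) w`).
* `integratedOperator_apply_eq_zero_of_normal` / `inner_integratedOperator_eq_zero_of_normal` — the assembled statement used by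
  trace formulas with a «silenced» compact factor: for `K` normal, `W` irreducible on which `K` does NOT act trivially, `η`
  right-invariant and `f` right `K`-invariant, `π(f) w = 0` and `⟪w′, π(f) w⟫ = 0` for all `w ∈ W` — so every diagonal
  coefficient of `π(f)` along a basis of `W` vanishes («`tr π(f) = tr (π(f) ∘ e_K) = 0` unless `π|_K` is trivial»,
  [BorelJacquet1979, §4.6]; [Dixmier1977, §13.1.5]; [DeitmarEchterhoff2014, Lemma 9.2.7]).

* §4 (ED. 2) the LEFT-translation road, which needs only a LEFT-invariant `η` (every Haar measure): for `f` LEFT `K`-invariant,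
  `π(k) ∘ π(f) = π(f)` (★ `apply_comp_integratedOperator`), so `π(f) w ∈ W ∩ W^K` (★ `integratedOperator_apply_mem`) — hence
  `π(f)|_W = 0` as soon as `W^K = 0`, with the same normal-subgroup dichotomy (`…_left` names).

Theorems only (no definition, no instance, no notation); deliberate dot-notation extensions in `namespace ContRepresentation`
as in ★ `IntegratedOperator`.  Mathlib: `MeasureTheory.integral_mul_right_eq_self`, `Submodule.topologicalClosure_minimal`,
`Submodule.HasOrthogonalProjection.exists_orthogonal`, `norm_sub_sq`, `inner_self_eq_norm_sq`; nothing here duplicates a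
Mathlib declaration (Mathlib has no integrated form of a representation).

## References

* A. Borel, H. Jacquet, *Automorphic forms and automorphic representations*, Corvallis 1979, Part 1, §4.6.
* J. Dixmier, *C\*-algebras* (1977), §13.1.5.
* A. Deitmar, S. Echterhoff, *Principles of harmonic analysis*, 2nd ed. (2014), Lemma 1.6.3, Lemma 9.2.7.
-/

noncomputable section

open scoped InnerProductSpace
open MeasureTheory Filter Topology CompactlySupported

namespace ContRepresentation

open Literature.NumberTheory.Automorphic

variable {G H : Type*} [Group G] [TopologicalSpace G] [MeasurableSpace G] [OpensMeasurableSpace G]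
  [NormedAddCommGroup H] [InnerProductSpace ℂ H] [CompleteSpace H] {π : ContRepresentation ℂ G H}

/-! ### Right translations: `π(f) ∘ π(k) = π(ρ_k f)` -/

section Translate

/-- **`π(f) ∘ π(k) = π(ρ_k f)`** with `(ρ_k f)(x) = f(x k⁻¹)`, for a right-invariant `η`:
`(∫ f(x) π(x) dη) π(k) v = ∫ f(x) π(x k) v dη = ∫ f(x k⁻¹) π(x) v dη` (substitution `x ↦ x k`; the operator form of
Deitmar–Echterhoff (2014), Lemma 1.6.3, right-translation version of ★ `apply_comp_integratedOperator`). [folklore]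
[cite: DeitmarEchterhoff2014, Lemma 1.6.3] -/
theorem integratedOperator_comp_apply_eq (hu : π.IsUnitary) (hc : π.IsStronglyContinuous)
    (η : Measure G) [IsFiniteMeasureOnCompacts η] [η.IsMulRightInvariant] [MeasurableMul G]
    (k : G) (f F : C_c(G, ℂ)) (hF : ∀ x, F x = f (x * k⁻¹)) :
    π.integratedOperator hu hc η f ∘L π k = π.integratedOperator hu hc η F := by
  ext v
  rw [ContinuousLinearMap.comp_apply, integratedOperator_apply, integratedOperator_apply,
    ← integral_mul_right_eq_self (fun x => F x • π x v) k]
  refine integral_congr_ae (Eventually.of_forall fun x => ?_)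
  change f x • π x (π k v) = F (x * k) • π (x * k) v
  rw [hF, mul_inv_cancel_right, map_mul π, mul_apply_eq_comp]

/-- **A RIGHT `K`-INVARIANT test function absorbs `K`**: if `f (x k) = f x` for all `k ∈ K` then `π(f) ∘ π(k) = π(f)` for
every `k ∈ K` (right-invariant `η`). [folklore] [cite: DeitmarEchterhoff2014, Lemma 1.6.3] -/
theorem integratedOperator_comp_apply_eq_self_of_forall_mul_eq (hu : π.IsUnitary) (hc : π.IsStronglyContinuous)
    (η : Measure G) [IsFiniteMeasureOnCompacts η] [η.IsMulRightInvariant] [MeasurableMul G]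
    (K : Subgroup G) (f : C_c(G, ℂ)) (hf : ∀ k ∈ K, ∀ x, f (x * k) = f x) {k : G} (hk : k ∈ K) :
    π.integratedOperator hu hc η f ∘L π k = π.integratedOperator hu hc η f :=
  integratedOperator_comp_apply_eq hu hc η k f f fun x => (hf k⁻¹ (K.inv_mem hk) x).symm

end Translate

/-! ### An operator absorbing `K` on the right vanishes on a block without `K`-fixed vectors -/

section Vanishing

omit [TopologicalSpace G] [MeasurableSpace G] [OpensMeasurableSpace G] in
/-- **If `T ∘ π(k) = T` for all `k ∈ K` and `W` has no non-zero `K`-fixed vector, then `T` vanishes on `W`** (`π` unitary,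
`W` closed invariant).  `T` kills `N :=` the closed span of `{π(k) v − v | k ∈ K, v ∈ W} ⊆ W`; for `q ∈ W ∩ Nᗮ` and `k ∈ K`,
`⟪π(k) q − q, q⟫ = 0` gives `re ⟪π(k) q, q⟫ = ‖q‖²`, so `‖π(k) q − q‖² = ‖π(k) q‖² − 2 re ⟪π(k) q, q⟫ + ‖q‖² = 0`: `q` is `K`-fixed,
hence `0`; so `W ≤ N ≤ ker T`. [folklore] [cite: Dixmier1977, §13.1.5] -/
theorem apply_eq_zero_of_forall_comp_eq_of_forall_fixed_eq_zero (hu : π.IsUnitary) (K : Subgroup G) (W : ClosedSubrep π)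
    (hW : ∀ w ∈ W, (∀ k ∈ K, π k w = w) → w = 0) (T : H →L[ℂ] H) (hT : ∀ k ∈ K, T ∘L π k = T)
    {w : H} (hw : w ∈ W) : T w = 0 := by
  -- the span `M` of the `π k v - v` and its closure `N`
  set M : Submodule ℂ H := Submodule.span ℂ {x | ∃ k ∈ K, ∃ v ∈ W, x = π k v - v} with hM
  have hMW : M ≤ W.toSubmodule := by
    refine Submodule.span_le.2 ?_
    rintro x ⟨k, -, v, hv, rfl⟩
    exact W.toSubmodule.sub_mem (W.apply_mem k hv) hv
  have hMT : M ≤ LinearMap.ker (T : H →ₗ[ℂ] H) := by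
    refine Submodule.span_le.2 ?_
    rintro x ⟨k, hk, v, -, rfl⟩
    change T (π k v - v) = 0
    rw [map_sub, ← ContinuousLinearMap.comp_apply, hT k hk, sub_self]
  set N : Submodule ℂ H := M.topologicalClosure with hN
  have hNW : N ≤ W.toSubmodule := M.topologicalClosure_minimal hMW W.isClosed
  have hNT : N ≤ LinearMap.ker (T : H →ₗ[ℂ] H) := M.topologicalClosure_minimal hMT (T.isClosed_ker)
  -- decompose `w = p + (w - p)` with `p ∈ N`, `w - p ⊥ N`
  obtain ⟨p, hpN, hq⟩ := Submodule.HasOrthogonalProjection.exists_orthogonal (K := N) w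
  have hqW : w - p ∈ W := W.toSubmodule.sub_mem hw (hNW hpN)
  -- `w - p` is `K`-fixed
  have hqfix : ∀ k ∈ K, π k (w - p) = w - p := by
    intro k hk
    set q := w - p with hqdef
    have hgen : π k q - q ∈ N :=
      M.le_topologicalClosure (Submodule.subset_span ⟨k, hk, q, hqW, rfl⟩)
    have h0 : ⟪π k q - q, q⟫_ℂ = 0 := (Submodule.mem_orthogonal N q).1 hq _ hgen
    have h1 : RCLike.re ⟪π k q, q⟫_ℂ = ‖q‖ ^ 2 := by
      rw [inner_sub_left, sub_eq_zero] at h0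
      rw [h0]
      exact inner_self_eq_norm_sq (𝕜 := ℂ) q
    have h2 : ‖π k q - q‖ ^ 2 = 0 := by
      rw [@norm_sub_sq ℂ, h1, hu.norm_map]
      ring
    rwa [sq_eq_zero_iff, norm_eq_zero, sub_eq_zero] at h2
  -- hence `w - p = 0`, `w = p ∈ N ≤ ker T`
  have hq0 : w - p = 0 := hW _ hqW hqfix
  rw [sub_eq_zero] at hq0
  rw [hq0]
  exact hNT hpN

/-- **`π(f)` vanishes on a block without `K`-fixed vectors when `f` is right `K`-invariant** (right-invariant `η`).
[folklore] [cite: BorelJacquet1979, §4.6] -/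
theorem integratedOperator_apply_eq_zero_of_forall_fixed_eq_zero (hu : π.IsUnitary) (hc : π.IsStronglyContinuous)
    (η : Measure G) [IsFiniteMeasureOnCompacts η] [η.IsMulRightInvariant] [MeasurableMul G]
    (K : Subgroup G) (W : ClosedSubrep π) (hW : ∀ w ∈ W, (∀ k ∈ K, π k w = w) → w = 0)
    (f : C_c(G, ℂ)) (hf : ∀ k ∈ K, ∀ x, f (x * k) = f x) {w : H} (hw : w ∈ W) :
    π.integratedOperator hu hc η f w = 0 :=
  apply_eq_zero_of_forall_comp_eq_of_forall_fixed_eq_zero hu K W hW _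
    (fun _ hk => integratedOperator_comp_apply_eq_self_of_forall_mul_eq hu hc η K f hf hk) hw

end Vanishing

/-! ### A normal subgroup acts trivially on an irreducible block or fixes nothing in it -/

section Normal

omit [TopologicalSpace G] [MeasurableSpace G] [OpensMeasurableSpace G] [CompleteSpace H] in
/-- **Dichotomy for a normal subgroup on an irreducible block.**  If `K ⊴ G` and the closed invariant subspace `W` is
topologically irreducible, then either every vector of `W` is `K`-fixed or the only `K`-fixed vector of `W` is `0`: the
`K`-fixed vectors of `W` form a CLOSED `G`-INVARIANT subspace (`π(k) (π(g) w) = π(g) (π(g⁻¹ k g) w) = π(g) w`), which is `⊥`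
or `W` (★ `ClosedSubrep.isTopIrreducible_toContRep_iff`). [folklore] [cite: Dixmier1977, §13.1.5] -/
theorem forall_fixed_or_forall_fixed_eq_zero_of_normal (K : Subgroup G) (hK : K.Normal) (W : ClosedSubrep π)
    (hW : W.toContRep.IsTopIrreducible) :
    (∀ w ∈ W, ∀ k ∈ K, π k w = w) ∨ (∀ w ∈ W, (∀ k ∈ K, π k w = w) → w = 0) := by
  -- the closed invariant subspace of `K`-fixed vectors of `W`
  let V : ClosedSubrep π :=
    { toSubmodule :=
        { carrier := {v | v ∈ W ∧ ∀ k ∈ K, π k v = v}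
          add_mem' := fun {a b} ha hb => ⟨W.toSubmodule.add_mem ha.1 hb.1, fun k hk => by rw [map_add, ha.2 k hk, hb.2 k hk]⟩
          zero_mem' := ⟨W.toSubmodule.zero_mem, fun k _ => map_zero _⟩
          smul_mem' := fun c {a} ha => ⟨W.toSubmodule.smul_mem c ha.1, fun k hk => by rw [map_smul, ha.2 k hk]⟩ }
      apply_mem_toSubmodule := fun g {v} hv => by
        refine ⟨W.apply_mem g hv.1, fun k hk => ?_⟩
        have hmem : g⁻¹ * k * g ∈ K := by simpa only [inv_inv] using hK.conj_mem k hk g⁻¹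
        calc π k (π g v) = π (g * (g⁻¹ * k * g)) v := by
              rw [← mul_apply_eq_comp, ← map_mul π, ← mul_assoc, ← mul_assoc, mul_inv_cancel, one_mul]
          _ = π g v := by rw [map_mul π, mul_apply_eq_comp, hv.2 _ hmem]
      isClosed' := by
        change IsClosed {v : H | v ∈ W ∧ ∀ k ∈ K, π k v = v}
        have h : {v : H | v ∈ W ∧ ∀ k ∈ K, π k v = v} = (W : Set H) ∩ ⋂ k ∈ K, {v : H | π k v = v} := by
          ext v
          simp only [Set.mem_inter_iff, Set.mem_iInter, Set.mem_setOf_eq, SetLike.mem_coe]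
        rw [h]
        exact W.isClosed.inter (isClosed_biInter fun k _ => isClosed_eq (π k).continuous continuous_id) }
  have hVle : V ≤ W := fun v hv => hv.1
  have hmemV : ∀ v : H, v ∈ V ↔ v ∈ W ∧ ∀ k ∈ K, π k v = v := fun v => Iff.rfl
  rcases ((ClosedSubrep.isTopIrreducible_toContRep_iff W).1 hW).2 V hVle with h0 | h1
  · right
    intro w hw hfix
    have hwV : w ∈ V := (hmemV w).2 ⟨hw, hfix⟩
    rw [h0] at hwV
    exact (ClosedSubrep.mem_bot).1 hwV
  · left
    intro w hw
    have hwV : w ∈ V := by rw [h1]; exact hw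
    exact ((hmemV w).1 hwV).2

/-- **The assembled vanishing statement.**  `K ⊴ G`, `W` a topologically irreducible closed invariant subspace on which `K`
does NOT act trivially, `η` right-invariant, `f ∈ C_c(G)` right `K`-invariant: `π(f) w = 0` for every `w ∈ W` («`π(f) =
π(f) ∘ e_K` and `W^K = 0`»). [folklore] [cite: BorelJacquet1979, §4.6] [cite: Dixmier1977, §13.1.5] -/
theorem integratedOperator_apply_eq_zero_of_normal (hu : π.IsUnitary) (hc : π.IsStronglyContinuous)
    (η : Measure G) [IsFiniteMeasureOnCompacts η] [η.IsMulRightInvariant] [MeasurableMul G]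
    (K : Subgroup G) (hK : K.Normal) (W : ClosedSubrep π) (hW : W.toContRep.IsTopIrreducible)
    (hnot : ¬ ∀ w ∈ W, ∀ k ∈ K, π k w = w)
    (f : C_c(G, ℂ)) (hf : ∀ k ∈ K, ∀ x, f (x * k) = f x) {w : H} (hw : w ∈ W) :
    π.integratedOperator hu hc η f w = 0 :=
  integratedOperator_apply_eq_zero_of_forall_fixed_eq_zero hu hc η K W
    ((forall_fixed_or_forall_fixed_eq_zero_of_normal K hK W hW).resolve_left hnot) f hf hw

/-- **Every matrix coefficient of `π(f)` on such a block vanishes**: `⟪w′, π(f) w⟫ = 0` for `w ∈ W` — in particular each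
diagonal term of «`tr π|_W(f)`» along a Hilbert basis of `W` is `0`. [folklore] [cite: BorelJacquet1979, §4.6] -/
theorem inner_integratedOperator_eq_zero_of_normal (hu : π.IsUnitary) (hc : π.IsStronglyContinuous)
    (η : Measure G) [IsFiniteMeasureOnCompacts η] [η.IsMulRightInvariant] [MeasurableMul G]
    (K : Subgroup G) (hK : K.Normal) (W : ClosedSubrep π) (hW : W.toContRep.IsTopIrreducible)
    (hnot : ¬ ∀ w ∈ W, ∀ k ∈ K, π k w = w)
    (f : C_c(G, ℂ)) (hf : ∀ k ∈ K, ∀ x, f (x * k) = f x) (w' : H) {w : H} (hw : w ∈ W) :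
    ⟪w', π.integratedOperator hu hc η f w⟫_ℂ = 0 := by
  rw [integratedOperator_apply_eq_zero_of_normal hu hc η K hK W hW hnot f hf hw, inner_zero_right]

/-- **The diagonal sum of `π(f)` along any family of vectors of such a block is `0`** (the form consumed by class traces
`Σ' i, ⟪e_i, π(f) e_i⟫`). [folklore] [cite: BorelJacquet1979, §4.6] -/
theorem tsum_inner_integratedOperator_eq_zero_of_normal (hu : π.IsUnitary) (hc : π.IsStronglyContinuous)
    (η : Measure G) [IsFiniteMeasureOnCompacts η] [η.IsMulRightInvariant] [MeasurableMul G]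
    (K : Subgroup G) (hK : K.Normal) (W : ClosedSubrep π) (hW : W.toContRep.IsTopIrreducible)
    (hnot : ¬ ∀ w ∈ W, ∀ k ∈ K, π k w = w)
    (f : C_c(G, ℂ)) (hf : ∀ k ∈ K, ∀ x, f (x * k) = f x) {ι : Type*} (e : ι → H) (he : ∀ i, e i ∈ W) :
    ∑' i, ⟪e i, π.integratedOperator hu hc η f (e i)⟫_ℂ = 0 := by
  simp_rw [fun i => inner_integratedOperator_eq_zero_of_normal hu hc η K hK W hW hnot f hf (e i) (he i)]
  exact tsum_zero

end Normal


/-! ### ED. 2 — the left-translation road: `π(k) ∘ π(f) = π(f)` for LEFT `K`-invariant `f` (left-invariant `η` only) -/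

section Left

variable [BorelSpace G]

/-- **A LEFT `K`-INVARIANT test function is absorbed by `K` on the left**: if `f (k x) = f x` for all `k ∈ K` then
`π(k) ∘ π(f) = π(f)` for every `k ∈ K` — ★ `apply_comp_integratedOperator` (`π(k) ∘ π(f) = π(λ_k f)`, left-invariant `η`,
every Haar measure). [folklore] [cite: DeitmarEchterhoff2014, Lemma 1.6.3] -/
theorem apply_comp_integratedOperator_eq_self_of_forall_mul_eq (hu : π.IsUnitary) (hc : π.IsStronglyContinuous)
    (η : Measure G) [IsFiniteMeasureOnCompacts η] [η.IsMulLeftInvariant] [MeasurableMul G]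
    (K : Subgroup G) (f : C_c(G, ℂ)) (hf : ∀ k ∈ K, ∀ x, f (k * x) = f x) {k : G} (hk : k ∈ K) :
    π k ∘L π.integratedOperator hu hc η f = π.integratedOperator hu hc η f :=
  apply_comp_integratedOperator hu hc η k f f fun x => (hf k⁻¹ (K.inv_mem hk) x).symm

/-- **`π(f)` vanishes on a block without `K`-fixed vectors when `f` is LEFT `K`-invariant** (left-invariant `η`): `π(f) w ∈ W`
(★ `integratedOperator_apply_mem`) is `K`-fixed (`π(k) (π(f) w) = π(f) w`), hence `0`.  No unimodularity needed.
[folklore] [cite: BorelJacquet1979, §4.6] -/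
theorem integratedOperator_apply_eq_zero_of_forall_fixed_eq_zero_left (hu : π.IsUnitary) (hc : π.IsStronglyContinuous)
    (η : Measure G) [IsFiniteMeasureOnCompacts η] [η.IsMulLeftInvariant] [MeasurableMul G]
    (K : Subgroup G) (W : ClosedSubrep π) (hW : ∀ w ∈ W, (∀ k ∈ K, π k w = w) → w = 0)
    (f : C_c(G, ℂ)) (hf : ∀ k ∈ K, ∀ x, f (k * x) = f x) {w : H} (hw : w ∈ W) :
    π.integratedOperator hu hc η f w = 0 :=
  hW _ (integratedOperator_apply_mem hu hc η f W hw) fun k hk => by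
    rw [← ContinuousLinearMap.comp_apply, apply_comp_integratedOperator_eq_self_of_forall_mul_eq hu hc η K f hf hk]

/-- **The assembled vanishing statement, left road.**  `K ⊴ G`, `W` a topologically irreducible closed invariant subspace on
which `K` does NOT act trivially, `η` LEFT-invariant (any Haar measure), `f ∈ C_c(G)` LEFT `K`-invariant: `π(f) w = 0` for every
`w ∈ W`. [folklore] [cite: BorelJacquet1979, §4.6] [cite: Dixmier1977, §13.1.5] -/
theorem integratedOperator_apply_eq_zero_of_normal_left (hu : π.IsUnitary) (hc : π.IsStronglyContinuous)
    (η : Measure G) [IsFiniteMeasureOnCompacts η] [η.IsMulLeftInvariant] [MeasurableMul G]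
    (K : Subgroup G) (hK : K.Normal) (W : ClosedSubrep π) (hW : W.toContRep.IsTopIrreducible)
    (hnot : ¬ ∀ w ∈ W, ∀ k ∈ K, π k w = w)
    (f : C_c(G, ℂ)) (hf : ∀ k ∈ K, ∀ x, f (k * x) = f x) {w : H} (hw : w ∈ W) :
    π.integratedOperator hu hc η f w = 0 :=
  integratedOperator_apply_eq_zero_of_forall_fixed_eq_zero_left hu hc η K W
    ((forall_fixed_or_forall_fixed_eq_zero_of_normal K hK W hW).resolve_left hnot) f hf hw

/-- Left road: every matrix coefficient `⟪w′, π(f) w⟫`, `w ∈ W`, vanishes. [folklore] [cite: BorelJacquet1979, §4.6] -/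
theorem inner_integratedOperator_eq_zero_of_normal_left (hu : π.IsUnitary) (hc : π.IsStronglyContinuous)
    (η : Measure G) [IsFiniteMeasureOnCompacts η] [η.IsMulLeftInvariant] [MeasurableMul G]
    (K : Subgroup G) (hK : K.Normal) (W : ClosedSubrep π) (hW : W.toContRep.IsTopIrreducible)
    (hnot : ¬ ∀ w ∈ W, ∀ k ∈ K, π k w = w)
    (f : C_c(G, ℂ)) (hf : ∀ k ∈ K, ∀ x, f (k * x) = f x) (w' : H) {w : H} (hw : w ∈ W) :
    ⟪w', π.integratedOperator hu hc η f w⟫_ℂ = 0 := by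
  rw [integratedOperator_apply_eq_zero_of_normal_left hu hc η K hK W hW hnot f hf hw, inner_zero_right]

/-- **Left road, the form consumed by class traces**: `∑' i, ⟪e_i, π(f) e_i⟫ = 0` along any family of vectors of such a block —
`K ⊴ G` not acting trivially on the irreducible `W`, `f` LEFT `K`-invariant, `η` any left-invariant (e.g. Haar) measure.
[folklore] [cite: BorelJacquet1979, §4.6] -/
theorem tsum_inner_integratedOperator_eq_zero_of_normal_left (hu : π.IsUnitary) (hc : π.IsStronglyContinuous)
    (η : Measure G) [IsFiniteMeasureOnCompacts η] [η.IsMulLeftInvariant] [MeasurableMul G]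
    (K : Subgroup G) (hK : K.Normal) (W : ClosedSubrep π) (hW : W.toContRep.IsTopIrreducible)
    (hnot : ¬ ∀ w ∈ W, ∀ k ∈ K, π k w = w)
    (f : C_c(G, ℂ)) (hf : ∀ k ∈ K, ∀ x, f (k * x) = f x) {ι : Type*} (e : ι → H) (he : ∀ i, e i ∈ W) :
    ∑' i, ⟪e i, π.integratedOperator hu hc η f (e i)⟫_ℂ = 0 := by
  simp_rw [fun i => inner_integratedOperator_eq_zero_of_normal_left hu hc η K hK W hW hnot f hf (e i) (he i)]
  exact tsum_zero

end Left

end ContRepresentation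

end
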